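import Mathlib.Data.Fintype.BigOperators
import Literature.Computability.AlgebraicComplexity.AutomatonIMM
import Literature.Computability.AlgebraicComplexity.IMMInVPProofs
import Literature.Computability.AlgebraicComplexity.ProjectedShiftedPartials
import Literature.Computability.AlgebraicComplexity.HomDepthFourNormalForm
import Mathlib.Algebra.BigOperators.GroupWithZero.Finset
import HarnessLib

/-!
# The sliding-window (binary de Bruijn walk) polynomial: definition, homogeneity, `VP`

Topic `Literature/Computability/AlgebraicComplexity`; the witness family of the discharge of
`Literature.Barriers.ValiantsHypothesis.DepthReductionChasmDepthFour` (Kumar–Saraf 2017,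
Cor. 1.3: "there exists a polynomial in `VP` of degree `n` in `n^{O(1)}` variables such that any
homogeneous `ΣΠΣΠ` circuit computing it has size `n^{Ω(√n)}`"). Kumar–Saraf's own witness is
`IMM`; the tree's rendering of Cor. 1.3 is existential over the family, and we discharge it with a
different explicit `VP` family designed so that the two probabilistic steps of the printed proof
(random restriction of the circuit, Lemma 8.2; expectation/variance analysis of `T₁,T₂,T₃`, §9)
become deterministic:

* **the polynomial** `swPoly K n t B`: variables `x_{ℓ, w, c}` for a layer `ℓ < n`, a window
  content `w ∈ {0,1}^{t+1}` and a copy index `c < B`; monomials: for every binary string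
  `z ∈ {0,1}^{n+t}` and every choice of copies `c : [n] → [B]`, the product over `ℓ` of
  `x_{ℓ, z[ℓ..ℓ+t], c ℓ}` — the sum over the walks of length `n` in the binary de Bruijn graph of
  order `t`, every edge variable duplicated `B` times. It is defined as the WORD POLYNOMIAL of the
  layered automaton whose state is the last `t` bits read (`LayeredAutomaton`, `AutomatonIMM.lean`),
  so that by `LayeredAutomaton.aeval_autSubst_immPoly` it is a linear projection of
  `IMM_{2^t, n}` and hence in `VP` (`isVPFamily_swPoly`), for `2^t` and `B` polynomial in `n`.
* `swPoly_isHomogeneous` — homogeneous of degree `n`.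

The description of its monomials by strings and the lower bound live in the sequel files.

## References

* M. Kumar, S. Saraf, *On the power of homogeneous depth 4 arithmetic circuits*, SIAM J. Comput.
  46 (2017) 336–387, Cor. 1.3, §3 (`IMM ∈ VP`).
* N. Limaye, S. Srinivasan, S. Tavenas, J. ACM 72 (2025), Art. 26, Lemma 8 (automata are
  projections of `IMM`; `AutomatonIMM.lean`).
-/

noncomputable section

open MvPolynomial

namespace Literature.Computability.AlgebraicComplexity

namespace SlidingWindow

/-! ### The automaton -/

/-- Window contents: `t + 1` bits. [folklore] -/
abbrev Win (t : ℕ) : Type := List.Vector Bool (t + 1)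

/-- States: the last `t` bits read. [folklore] -/
abbrev St (t : ℕ) : Type := List.Vector Bool t

/-- Letters at every layer: a window content and a copy index (`B + 1` copies, so that the
type is inhabited). [folklore] -/
abbrev Letter (t B : ℕ) : Type := Win t × Fin (B + 1)

/-- The variables of `swPoly K n t B`: `x_{ℓ, w, c}`. [folklore] -/
abbrev Var (n t B : ℕ) : Type := Σ _ : Fin n, Letter t B

/-- The start state `0^t` (irrelevant: the first letter is accepted from any state).
[folklore] -/
def start (t : ℕ) : St t := ⟨List.replicate t false, List.length_replicate⟩

/-- The transition: at layer `0` any window is read; at a layer `ℓ ≥ 1` the window `w` must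
extend the state `s` (its first `t` bits are `s`); the new state is the last `t` bits of `w`.
[folklore] -/
def step (n t B : ℕ) (ℓ : Fin n) (s : St t) (a : Letter t B) : Option (St t) :=
  if ℓ.val = 0 ∨ a.1.toList.take t = s.toList then
    some ⟨a.1.toList.drop 1, by rw [List.length_drop, a.1.toList_length]; omega⟩
  else none

/-- The number of states is `2^t`. [folklore] -/
theorem card_St (t : ℕ) : Fintype.card (St t) = 2 ^ t := by
  rw [card_vector, Fintype.card_bool]

/-- The state encoding into `Fin (2^t)` (a bijection). [folklore] -/
def enc (t : ℕ) (_ℓ : ℕ) : St t → Fin (2 ^ t) := Fintype.equivFinOfCardEq (card_St t)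

/-- The encoding is injective. [folklore] -/
theorem enc_injective (t ℓ : ℕ) : Function.Injective (enc t ℓ) :=
  (Fintype.equivFinOfCardEq (card_St t)).injective

variable (K : Type*) [CommSemiring K]

/-- **The sliding-window polynomial** `∑_{accepted words w} ∏_ℓ x_{ℓ, w ℓ}`: the word polynomial
of the window automaton (equivalently — sequel file — the sum over binary strings
`z ∈ {0,1}^{n+t}` and copy choices `c` of `∏_ℓ x_{ℓ, z[ℓ..ℓ+t], c ℓ}`). [folklore] -/
def swPoly (n t B : ℕ) : MvPolynomial (Var n t B) K :=
  ∑ w : (ℓ : Fin n) → Letter t B,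
    if LayeredAutomaton.Accepts (St := fun _ => St t) (start t) (step n t B) w then
      ∏ ℓ : Fin n, X ⟨ℓ, w ℓ⟩ else 0

/-- **`swPoly` is a projection of `IMM_{2^t, n}`** (`0 < n`): it is `aeval` of the automaton
substitution applied to `immPoly (2^t) n K`. [cite: LimayeSrinivasanTavenas2021, Lemma 8] -/
theorem swPoly_eq_aeval {n : ℕ} (hn : 0 < n) (t B : ℕ) :
    swPoly K n t B = aeval (LayeredAutomaton.autSubst (K := K) (St := fun _ => St t)
      (start t) (step n t B) (enc t)) (immPoly (2 ^ t) n K) := by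
  rw [LayeredAutomaton.aeval_autSubst_immPoly (St := fun _ => St t) (start t) (step n t B)
    (enc t) (fun ℓ _ => enc_injective t ℓ) hn]
  rfl

/-- **`swPoly` is homogeneous of degree `n`** (every monomial is a product of `n` variables).
[folklore] -/
theorem swPoly_isHomogeneous (n t B : ℕ) : (swPoly K n t B).IsHomogeneous n := by
  unfold swPoly
  refine IsHomogeneous.sum _ _ _ fun w _ => ?_
  split_ifs
  · have h := IsHomogeneous.prod (Finset.univ : Finset (Fin n)) (fun ℓ => (X ⟨ℓ, w ℓ⟩ :
      MvPolynomial (Var n t B) K)) (fun _ => 1) (fun ℓ _ => isHomogeneous_X K _)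
    simpa using h
  · exact isHomogeneous_zero _ _ _

/-! ### Complexity and `VP` -/

/-- The automaton substitution has small complexity: each `IMM` variable is sent to a `0/1`-sum
of at most `|Letter|` variables. [folklore] -/
theorem complexity_autSubst_le (n t B : ℕ) (v : Fin n × Fin (2 ^ t) × Fin (2 ^ t)) :
    complexity (LayeredAutomaton.autSubst (K := K) (St := fun _ => St t) (start t) (step n t B)
      (enc t) v) ≤ Fintype.card (Letter t B) := by
  classical
  unfold LayeredAutomaton.autSubst
  refine (complexity_finset_sum_le _ _).trans ?_
  have h0 : ∀ b : Letter t B, complexity ((if LayeredAutomaton.Trans (St := fun _ => St t)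
      (start t) (step n t B) (enc t) v.1 v.2.1 b v.2.2 then X ⟨v.1, b⟩ else 0 :
        MvPolynomial (Var n t B) K)) = 0 := by
    intro b
    split_ifs
    · exact complexity_X_holds _
    · simpa using complexity_C_holds (σ := Var n t B) (0 : K)
  simp only [h0, Finset.sum_const_zero, zero_add, Finset.card_univ]
  rfl

/-- **Complexity of `swPoly`**: `L(swPoly) ≤ (2^t + 2·(2^t)³ n) + n (2^t)² · (2^{t+1} B)`
(the `IMM` circuit plus the substitution, `complexity_aeval_le`). [cite: KumarSaraf2017, §3] -/
theorem complexity_swPoly_le (n t B : ℕ) :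
    complexity (swPoly K n t B) ≤
      (2 ^ t + 2 * (2 ^ t) ^ 3 * n) + n * (2 ^ t) ^ 2 * (2 ^ (t + 1) * (B + 1)) := by
  classical
  rcases Nat.eq_zero_or_pos n with rfl | hn
  · -- no layers: `swPoly` is a constant
    have h : swPoly K 0 t B = ∑ w : (ℓ : Fin 0) → Letter t B,
        if LayeredAutomaton.Accepts (St := fun _ => St t) (start t) (step 0 t B) w then 1 else 0 := by
      unfold swPoly
      refine Finset.sum_congr rfl fun w _ => ?_
      simp
    have hc : ∃ c : K, swPoly K 0 t B = C c := by
      rw [h]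
      refine ⟨∑ w : (ℓ : Fin 0) → Letter t B, if LayeredAutomaton.Accepts (St := fun _ => St t)
        (start t) (step 0 t B) w then 1 else 0, ?_⟩
      rw [map_sum]
      refine Finset.sum_congr rfl fun w _ => ?_
      split_ifs <;> simp
    obtain ⟨c, hc⟩ := hc
    rw [hc, complexity_C_holds]
    exact Nat.zero_le _
  · rw [swPoly_eq_aeval K hn]
    refine (complexity_aeval_le _ _).trans (Nat.add_le_add (complexity_immPoly_le K _ _) ?_)
    calc ∑ v, complexity (LayeredAutomaton.autSubst (K := K) (St := fun _ => St t) (start t)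
          (step n t B) (enc t) v)
        ≤ ∑ _v : Fin n × Fin (2 ^ t) × Fin (2 ^ t), Fintype.card (Letter t B) :=
          Finset.sum_le_sum fun v _ => complexity_autSubst_le K n t B v
      _ = n * (2 ^ t) ^ 2 * (2 ^ (t + 1) * (B + 1)) := by
          rw [Finset.sum_const, Finset.card_univ, smul_eq_mul, Fintype.card_prod, Fintype.card_prod,
            Fintype.card_fin, Fintype.card_fin, Fintype.card_prod, card_vector, Fintype.card_bool,
            Fintype.card_fin]
          ring

/-- The number of variables of `swPoly K n t B` is `n · 2^{t+1} · (B + 1)`. [folklore] -/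
theorem card_Var (n t B : ℕ) : Fintype.card (Var n t B) = n * (2 ^ (t + 1) * (B + 1)) := by
  rw [Fintype.card_sigma, Finset.sum_const, Finset.card_univ, Fintype.card_fin, smul_eq_mul,
    Fintype.card_prod, card_vector, Fintype.card_bool, Fintype.card_fin]

variable {K}

/-- **The sliding-window family is in `VP`** whenever `2^{t(n)}` and `B(n)` are polynomially
bounded: `n · 2^{t+1} · B` variables, degree `n`, complexity as in `complexity_swPoly_le`
(Kumar–Saraf 2017, Cor. 1.3 asks for "a polynomial in `VP` of degree `n` in `N = n^{O(1)}`
variables"). [cite: KumarSaraf2017, Cor. 1.3] -/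
theorem isVPFamily_swPoly (K : Type*) [Field K] {t B : ℕ → ℕ} (ht : IsPBounded fun n => 2 ^ t n)
    (hB : IsPBounded B) : IsVPFamily (k := K) fun n => swPoly K n (t n) (B n) := by
  have h2t1 : IsPBounded fun n => 2 ^ (t n + 1) := by
    have := IsPBounded.mul_holds ht (IsPBounded.const 2)
    refine this.mono fun n => ?_
    rw [pow_succ]
  have hB1 : IsPBounded fun n => B n + 1 := IsPBounded.add_holds hB (IsPBounded.const 1)
  refine ⟨⟨?_, ?_⟩, ?_⟩
  · -- variables
    have h := IsPBounded.mul_holds IsPBounded.id (IsPBounded.mul_holds h2t1 hB1)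
    refine h.mono fun n => ?_
    rw [card_Var]
    rfl
  · -- degree
    exact IsPBounded.id.mono fun n => (swPoly_isHomogeneous K n (t n) (B n)).totalDegree_le
  · -- complexity
    have hA : IsPBounded fun n => 2 ^ t n + 2 * (2 ^ t n) ^ 3 * n :=
      IsPBounded.add_holds ht (IsPBounded.mul_holds
        (IsPBounded.mul_holds (IsPBounded.const 2) (IsPBounded.pow_holds ht 3)) IsPBounded.id)
    have hC : IsPBounded fun n => n * (2 ^ t n) ^ 2 * (2 ^ (t n + 1) * (B n + 1)) :=
      IsPBounded.mul_holds (IsPBounded.mul_holds IsPBounded.id (IsPBounded.pow_holds ht 2))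
        (IsPBounded.mul_holds h2t1 hB1)
    exact (IsPBounded.add_holds hA hC).mono fun n => complexity_swPoly_le K n (t n) (B n)

/-! ### Windows of strings (list level) -/

section Strings

/-- The window of `z` at position `ℓ`: `z[ℓ], …, z[ℓ+t]`. [folklore] -/
def winL (t : ℕ) (z : List Bool) (ℓ : ℕ) : List Bool := (z.drop ℓ).take (t + 1)

/-- A full window has `t + 1` bits. [folklore] -/
theorem length_winL {t : ℕ} {z : List Bool} {ℓ : ℕ} (h : ℓ + t + 1 ≤ z.length) :
    (winL t z ℓ).length = t + 1 := by
  rw [winL, List.length_take, List.length_drop]; omega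

/-- The bits of a window. [folklore] -/
theorem getElem_winL {t : ℕ} {z : List Bool} {ℓ j : ℕ} (h : ℓ + t + 1 ≤ z.length) (hj : j < t + 1) :
    (winL t z ℓ)[j]'(by rw [length_winL h]; exact hj) = z[ℓ + j]'(by omega) := by
  simp [winL, List.getElem_take, List.getElem_drop]

/-- Consecutive windows overlap in `t` bits. [folklore] -/
theorem take_winL_succ (t : ℕ) (z : List Bool) (ℓ : ℕ) :
    (winL t z (ℓ + 1)).take t = (winL t z ℓ).drop 1 := by
  rw [winL, winL, List.take_take, List.drop_take, List.drop_drop]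
  simp

/-- A string is determined by its windows. [folklore] -/
theorem ext_of_winL_eq {t n : ℕ} (hn : 0 < n) {z z' : List Bool} (hz : z.length = n + t)
    (hz' : z'.length = n + t) (h : ∀ ℓ, ℓ < n → winL t z ℓ = winL t z' ℓ) : z = z' := by
  refine List.ext_getElem (by rw [hz, hz']) fun p hp hp' => ?_
  rw [hz] at hp
  by_cases hpt : p ≤ t
  · have h0 := h 0 hn
    have e1 := getElem_winL (t := t) (z := z) (ℓ := 0) (j := p) (by omega) (by omega)
    have e2 := getElem_winL (t := t) (z := z') (ℓ := 0) (j := p) (by omega) (by omega)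
    simp only [zero_add] at e1 e2
    rw [← e1, ← e2]
    simp only [h0]
  · push Not at hpt
    have hl : p - t < n := by omega
    have h1 := h (p - t) hl
    have e1 := getElem_winL (t := t) (z := z) (ℓ := p - t) (j := t) (by omega) (by omega)
    have e2 := getElem_winL (t := t) (z := z') (ℓ := p - t) (j := t) (by omega) (by omega)
    have hp2 : p - t + t = p := by omega
    simp only [hp2] at e1 e2
    rw [← e1, ← e2]
    simp only [h1]

/-- **Reconstruction**: a consistent sequence of `n ≥ 1` windows is the window sequence of a
string of length `n + t`. [folklore] -/
theorem exists_string_of_consistent {t n : ℕ} (hn : 0 < n) (w : ℕ → List Bool)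
    (hw : ∀ ℓ, ℓ < n → (w ℓ).length = t + 1)
    (hcons : ∀ ℓ, ℓ + 1 < n → (w (ℓ + 1)).take t = (w ℓ).drop 1) :
    ∃ z : List Bool, z.length = n + t ∧ ∀ ℓ, ℓ < n → winL t z ℓ = w ℓ := by
  -- by induction on the number `m + 1 ≤ n` of windows matched
  suffices key : ∀ m, m < n → ∃ z : List Bool, z.length = m + 1 + t ∧
      ∀ ℓ, ℓ ≤ m → winL t z ℓ = w ℓ by
    obtain ⟨z, hz, hzw⟩ := key (n - 1) (by omega)
    exact ⟨z, by rw [hz]; omega, fun ℓ hℓ => hzw ℓ (by omega)⟩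
  intro m
  induction m with
  | zero =>
    intro _
    refine ⟨w 0, by rw [hw 0 hn]; omega, fun ℓ hℓ => ?_⟩
    obtain rfl : ℓ = 0 := Nat.le_zero.1 hℓ
    rw [winL, List.drop_zero, List.take_of_length_le (by rw [hw 0 hn])]
  | succ m ih =>
    intro hm
    obtain ⟨z, hz, hzw⟩ := ih (by omega)
    -- append the last bit of the window `m + 1`
    have hwlen := hw (m + 1) hm
    set b : Bool := (w (m + 1))[t]'(by rw [hwlen]; omega) with hb
    refine ⟨z ++ [b], by rw [List.length_append, hz, List.length_singleton]; omega, fun ℓ hℓ => ?_⟩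
    rcases Nat.lt_or_ge ℓ (m + 1) with hlt | hge
    · -- an old window
      rw [← hzw ℓ (by omega), winL, winL, List.drop_append_of_le_length (by omega),
        List.take_append_of_le_length (by rw [List.length_drop]; omega)]
    · -- the new window `ℓ = m + 1`
      obtain rfl : ℓ = m + 1 := le_antisymm hℓ hge
      have hdrop : z.drop (m + 1) = (w m).drop 1 := by
        have h1 : winL t z m = w m := hzw m le_rfl
        rw [winL, List.take_of_length_le (by rw [List.length_drop]; omega)] at h1
        rw [← List.drop_drop, h1]
      rw [winL, List.drop_append_of_le_length (by omega), hdrop, ← hcons m hm,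
        List.take_of_length_le (by
          rw [List.length_append, List.length_take, List.length_singleton, hwlen]; omega)]
      -- `take t (w (m+1)) ++ [w (m+1)[t]] = w (m+1)`
      rw [hb, List.take_concat_get', List.take_of_length_le (by rw [hwlen])]


end Strings

/-! ### Accepted words are the window sequences of strings -/

section Words

variable {n t B : ℕ}

/-- The window of the string `z ∈ {0,1}^{n+t}` at layer `ℓ < n`, as a letter component.
[folklore] -/
def win (z : List.Vector Bool (n + t)) (ℓ : Fin n) : Win t :=
  ⟨winL t z.toList ℓ, length_winL (by rw [z.toList_length]; omega)⟩

/-- The word of a string and a choice of copies. [folklore] -/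
def wordOf (p : List.Vector Bool (n + t) × (Fin n → Fin (B + 1))) (ℓ : Fin n) : Letter t B :=
  (win p.1 ℓ, p.2 ℓ)

/-- Unfolding `win`. [folklore] -/
@[simp] theorem toList_win (z : List.Vector Bool (n + t)) (ℓ : Fin n) :
    (win z ℓ).toList = winL t z.toList ℓ := rfl

/-- The letters of a word, as lists indexed by `ℕ` (junk `[]` out of range). [folklore] -/
def wl (w : (ℓ : Fin n) → Letter t B) (i : ℕ) : List Bool :=
  if h : i < n then (w ⟨i, h⟩).1.toList else []

/-- `wl` in range. [folklore] -/
theorem wl_of_lt (w : (ℓ : Fin n) → Letter t B) {i : ℕ} (h : i < n) : wl w i = (w ⟨i, h⟩).1.toList :=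
  dif_pos h

/-- Letters have `t + 1` bits. [folklore] -/
theorem length_wl (w : (ℓ : Fin n) → Letter t B) {i : ℕ} (h : i < n) : (wl w i).length = t + 1 := by
  rw [wl_of_lt w h, List.Vector.toList_length]

/-- Consistency of the first `ℓ` windows of a word: consecutive windows overlap in `t` bits.
[folklore] -/
def Cons (w : (ℓ : Fin n) → Letter t B) (ℓ : ℕ) : Prop :=
  ∀ i, i + 1 < ℓ → i + 1 < n → (wl w (i + 1)).take t = (wl w i).drop 1

/-- **The run of the window automaton**: after `ℓ ≥ 1` consistent letters the state is the last
`t` bits of the last window; an inconsistency aborts the run. [folklore] -/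
theorem run_spec (w : (ℓ : Fin n) → Letter t B) :
    ∀ ℓ, ℓ ≤ n → (∀ s, LayeredAutomaton.run (St := fun _ => St t) (start t) (step n t B) w ℓ = some s →
        Cons w ℓ ∧ (1 ≤ ℓ → s.toList = (wl w (ℓ - 1)).drop 1)) ∧
      (Cons w ℓ → ∃ s, LayeredAutomaton.run (St := fun _ => St t) (start t) (step n t B) w ℓ = some s) := by
  intro ℓ
  induction ℓ with
  | zero =>
    intro _
    refine ⟨fun s _ => ⟨fun i hi _ => absurd hi (Nat.not_lt_zero _), fun h => absurd h (by omega)⟩,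
      fun _ => ⟨start t, rfl⟩⟩
  | succ ℓ ih =>
    intro hℓ
    have hℓn : ℓ < n := hℓ
    obtain ⟨ih1, ih2⟩ := ih hℓn.le
    rw [LayeredAutomaton.run_succ (St := fun _ => St t) (start t) (step n t B) w ℓ hℓn]
    constructor
    · intro s hs
      -- the previous run is defined
      cases hr : LayeredAutomaton.run (St := fun _ => St t) (start t) (step n t B) w ℓ with
      | none => rw [hr] at hs; exact absurd hs (by simp)
      | some s₀ =>
        rw [hr, Option.bind_some] at hs
        obtain ⟨hc, hs₀⟩ := ih1 s₀ hr
        unfold step at hs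
        split_ifs at hs with hcond
        · have hs' := (Option.some.inj hs).symm
          refine ⟨fun i hi hin => ?_, fun _ => ?_⟩
          · rcases Nat.lt_or_ge (i + 1) ℓ with hlt | hge
            · exact hc i hlt hin
            · obtain rfl : i + 1 = ℓ := by omega
              rcases hcond with h0 | h0
              · exact absurd h0 (by simp)
              · rw [wl_of_lt w hℓn, h0, hs₀ (by omega)]
                simp
          · rw [hs', Nat.add_sub_cancel, wl_of_lt w hℓn]
            rfl
    · intro hc
      have hc' : Cons w ℓ := fun i hi hin => hc i (by omega) hin
      obtain ⟨s₀, hs₀⟩ := ih2 hc'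
      rw [hs₀, Option.bind_some]
      unfold step
      refine ⟨_, if_pos ?_⟩
      rcases Nat.eq_zero_or_pos ℓ with rfl | hpos
      · left; rfl
      · right
        have h1 := (ih1 s₀ hs₀).2 hpos
        have h2 := hc (ℓ - 1) (by omega) (by omega)
        rw [show ℓ - 1 + 1 = ℓ by omega, wl_of_lt w hℓn] at h2
        rw [h2, h1]

/-- **Acceptance is consistency.** [folklore] -/
theorem accepts_iff_cons (w : (ℓ : Fin n) → Letter t B) :
    LayeredAutomaton.Accepts (St := fun _ => St t) (start t) (step n t B) w ↔ Cons w n := by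
  rw [LayeredAutomaton.accepts_iff]
  obtain ⟨h1, h2⟩ := run_spec w n le_rfl
  exact ⟨fun ⟨s, hs⟩ => (h1 s hs).1, h2⟩

/-- Words of strings are consistent. [folklore] -/
theorem cons_wordOf (p : List.Vector Bool (n + t) × (Fin n → Fin (B + 1))) (ℓ : ℕ) :
    Cons (wordOf p) ℓ := by
  intro i _ hin
  rw [wl_of_lt _ hin, wl_of_lt _ (by omega : i < n)]
  exact take_winL_succ t p.1.toList i

/-- `wordOf` is injective (`0 < n`): the windows determine the string. [folklore] -/
theorem wordOf_injective (hn : 0 < n) :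
    Function.Injective (wordOf (n := n) (t := t) (B := B)) := by
  intro p q h
  refine Prod.ext ?_ (funext fun ℓ => congrArg Prod.snd (congrFun h ℓ))
  apply List.Vector.eq
  refine ext_of_winL_eq hn p.1.toList_length q.1.toList_length fun ℓ hℓ => ?_
  have h1 := congrArg (fun a : Letter t B => a.1.toList) (congrFun h ⟨ℓ, hℓ⟩)
  exact h1

/-- **The accepted words are exactly the words of strings** (`0 < n`). [folklore] -/
theorem accepts_iff_mem_image (hn : 0 < n) (w : (ℓ : Fin n) → Letter t B) :
    LayeredAutomaton.Accepts (St := fun _ => St t) (start t) (step n t B) w ↔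
      w ∈ Finset.univ.image (wordOf (n := n) (t := t) (B := B)) := by
  classical
  rw [Finset.mem_image]
  constructor
  · intro hw
    rw [accepts_iff_cons] at hw
    obtain ⟨z, hz, hzw⟩ := exists_string_of_consistent hn (wl w) (fun ℓ h => length_wl w h)
      (fun ℓ h => hw ℓ (by omega) h)
    refine ⟨(⟨z, hz⟩, fun ℓ => (w ℓ).2), Finset.mem_univ _, funext fun ℓ => Prod.ext ?_ rfl⟩
    apply List.Vector.eq
    change winL t z ℓ = (w ℓ).1.toList
    rw [hzw ℓ ℓ.2, wl_of_lt w ℓ.2]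
  · rintro ⟨p, -, rfl⟩
    exact (accepts_iff_cons _).2 (cons_wordOf p n)

variable (K : Type*) [CommSemiring K]

/-- **`swPoly` as a sum over strings and copy choices** (`0 < n`):
`swPoly = ∑_{z, c} ∏_ℓ x_{ℓ, z[ℓ..ℓ+t], c ℓ}`. [folklore] -/
theorem swPoly_eq_sum_wordOf (hn : 0 < n) :
    swPoly K n t B = ∑ p : List.Vector Bool (n + t) × (Fin n → Fin (B + 1)),
      ∏ ℓ : Fin n, X ⟨ℓ, wordOf p ℓ⟩ := by
  classical
  unfold swPoly
  rw [Finset.sum_congr rfl fun w _ => if_congr (accepts_iff_mem_image hn w) rfl rfl,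
    Finset.sum_ite_mem, Finset.univ_inter,
    Finset.sum_image fun p _ q _ h => wordOf_injective hn h]

/-! ### Copy selectors and the restricted polynomial -/

/-- The variables kept by a **copy selector** `g`: `x_{ℓ, w, g ℓ w}` — one copy of each window
variable (this plays the role of the alive set `V` of Kumar–Saraf's random restriction).
[cite: KumarSaraf2017, §8.3] -/
def selVars (g : Fin n → Win t → Fin (B + 1)) : Finset (Var n t B) :=
  Finset.univ.filter fun v => v.2.2 = g v.1 v.2.1

/-- Membership in `selVars`. [cite: KumarSaraf2017, §8.3] -/
@[simp] theorem mem_selVars {g : Fin n → Win t → Fin (B + 1)} {v : Var n t B} :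
    v ∈ selVars g ↔ v.2.2 = g v.1 v.2.1 := by
  simp [selVars]

/-- The variable of the string `z` at layer `ℓ` under the selector `g`. [folklore] -/
def varOf (g : Fin n → Win t → Fin (B + 1)) (z : List.Vector Bool (n + t)) (ℓ : Fin n) : Var n t B :=
  ⟨ℓ, (win z ℓ, g ℓ (win z ℓ))⟩

/-- `ℓ ↦ varOf g z ℓ` is injective (the layer is a component). [folklore] -/
theorem varOf_injective (g : Fin n → Win t → Fin (B + 1)) (z : List.Vector Bool (n + t)) :
    Function.Injective (varOf g z) := fun _ _ h => congrArg Sigma.fst h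

/-- **The variable set `E_g(z)` of the string `z` under the selector `g`**: the `n` variables
`x_{ℓ, z[ℓ..ℓ+t], g ℓ (z[ℓ..ℓ+t])}`. [folklore] -/
def Ez (g : Fin n → Win t → Fin (B + 1)) (z : List.Vector Bool (n + t)) : Finset (Var n t B) :=
  Finset.univ.image (varOf g z)

/-- Membership in `E_g(z)`. [folklore] -/
theorem mem_Ez {g : Fin n → Win t → Fin (B + 1)} {z : List.Vector Bool (n + t)} {v : Var n t B} :
    v ∈ Ez g z ↔ ∃ ℓ, varOf g z ℓ = v := by
  simp [Ez]

/-- `|E_g(z)| = n`. [folklore] -/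
theorem card_Ez (g : Fin n → Win t → Fin (B + 1)) (z : List.Vector Bool (n + t)) :
    (Ez g z).card = n := by
  rw [Ez, Finset.card_image_of_injective _ (varOf_injective g z), Finset.card_univ, Fintype.card_fin]

/-- The monomial of `E_g(z)` is the product of its variables. [folklore] -/
theorem prod_X_varOf (g : Fin n → Win t → Fin (B + 1)) (z : List.Vector Bool (n + t)) :
    ∏ ℓ : Fin n, (X (varOf g z ℓ) : MvPolynomial (Var n t B) K) =
      monomial (KumarSaraf.chi (Ez g z)) 1 := by
  rw [KumarSaraf.chi, Ez, Finset.sum_image fun _ _ _ _ h => varOf_injective g z h,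
    monomial_sum_one]
  rfl

/-- **The restriction of `swPoly` to one copy per window** (`0 < n`):
`swPoly|_{selVars g} = ∑_z x^{E_g(z)}`. [cite: KumarSaraf2017, §8.3] -/
theorem restrictVars_swPoly (hn : 0 < n) (g : Fin n → Win t → Fin (B + 1)) :
    restrictVars (selVars g) (swPoly K n t B) =
      ∑ z : List.Vector Bool (n + t), monomial (KumarSaraf.chi (Ez g z)) (1 : K) := by
  classical
  rw [swPoly_eq_sum_wordOf K hn, map_sum, Fintype.sum_prod_type]
  refine Finset.sum_congr rfl fun z _ => ?_
  have hres : ∀ c : Fin n → Fin (B + 1), restrictVars (selVars g)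
      (∏ ℓ : Fin n, (X ⟨ℓ, wordOf (z, c) ℓ⟩ : MvPolynomial (Var n t B) K)) =
      if c = fun ℓ => g ℓ (win z ℓ) then ∏ ℓ : Fin n, X (varOf g z ℓ) else 0 := by
    intro c
    rw [map_prod]
    have h1 : ∀ ℓ : Fin n, restrictVars (selVars g) (X ⟨ℓ, wordOf (z, c) ℓ⟩ : MvPolynomial (Var n t B) K) =
        if c ℓ = g ℓ (win z ℓ) then X (varOf g z ℓ) else 0 := by
      intro ℓ
      rw [restrictVars, aeval_X]
      by_cases h : c ℓ = g ℓ (win z ℓ)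
      · have hm : (⟨ℓ, wordOf (z, c) ℓ⟩ : Var n t B) ∈ selVars g := mem_selVars.2 h
        rw [if_pos hm, if_pos h]
        simp only [wordOf, varOf, h]
      · rw [if_neg (fun hm => h (mem_selVars.1 hm)), if_neg h]
    simp_rw [h1]
    rw [Fintype.prod_ite_zero]
    congr 1
    exact propext ⟨fun h => funext h, fun h ℓ => congrFun h ℓ⟩
  simp_rw [hres]
  rw [Finset.sum_ite_eq' Finset.univ (fun ℓ => g ℓ (win z ℓ)), if_pos (Finset.mem_univ _),
    prod_X_varOf]

/-! ### Existence of a good copy selector (deterministic form of Kumar–Saraf's Lemma 8.2) -/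

/-- **A selector killing all high-support bottom monomials exists** whenever there are fewer than
`(B+1)^{s+1} / …` of them: if `|M| · (B+1)^{n 2^{t+1} - (s+1)} < (B+1)^{n 2^{t+1}}` then some
`g` has: every `e ∈ M` all of whose variables are selected by `g` has support `≤ s`
(a monomial with `≥ s + 1` selected variables pins `g` on `≥ s + 1` window variables, and
`|M|` such events cannot cover all selectors — Kumar–Saraf, Lemma 8.2: "by the union bound, the
probability that at least one gate with support larger than `s` survives is at most
`Size(C)/n^s`"). [cite: KumarSaraf2017, Lemma 8.2] -/
theorem exists_good_selector {s : ℕ} (M : Finset (Var n t B →₀ ℕ))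
    (hM : M.card * (B + 1) ^ (Fintype.card (Fin n × Win t) - (s + 1)) <
      (B + 1) ^ Fintype.card (Fin n × Win t)) :
    ∃ g : Fin n → Win t → Fin (B + 1),
      ∀ e ∈ M, e.support ⊆ selVars g → e.support.card ≤ s := by
  classical
  -- the bad selectors for `e`
  set bad : (Var n t B →₀ ℕ) → Finset (Fin n → Win t → Fin (B + 1)) :=
    fun e => Finset.univ.filter fun g => e.support ⊆ selVars g ∧ s + 1 ≤ e.support.card with hbad
  -- each bad set is small
  have hsmall : ∀ e, (bad e).card ≤ (B + 1) ^ (Fintype.card (Fin n × Win t) - (s + 1)) := by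
    intro e
    by_cases hne : (bad e).Nonempty
    · obtain ⟨g₀, hg₀⟩ := hne
      rw [hbad, Finset.mem_filter] at hg₀
      obtain ⟨-, hsub₀, hcard₀⟩ := hg₀
      -- the pinned window variables
      set T : Finset (Fin n × Win t) := e.support.image fun v => (v.1, v.2.1) with hT
      have hTcard : T.card = e.support.card := by
        refine Finset.card_image_of_injOn fun v hv v' hv' h => ?_
        have h1 := mem_selVars.1 (hsub₀ hv)
        have h2 := mem_selVars.1 (hsub₀ hv')
        simp only [Prod.mk.injEq] at h
        obtain ⟨ha, hb⟩ := h
        rcases v with ⟨ℓ, w, c⟩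
        rcases v' with ⟨ℓ', w', c'⟩
        simp only at ha hb h1 h2
        subst ha; subst hb
        rw [h1, h2]
      -- restriction to the complement of `T` is injective on `bad e`
      have hinj : Set.InjOn (fun (g : Fin n → Win t → Fin (B + 1)) (p : {p : Fin n × Win t // p ∉ T}) =>
          g p.1.1 p.1.2) (bad e : Set (Fin n → Win t → Fin (B + 1))) := by
        intro g hg g' hg' h
        rw [Finset.mem_coe, hbad, Finset.mem_filter] at hg hg'
        funext ℓ w
        by_cases hp : (ℓ, w) ∈ T
        · rw [hT, Finset.mem_image] at hp
          obtain ⟨v, hv, hvp⟩ := hp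
          simp only [Prod.mk.injEq] at hvp
          obtain ⟨rfl, rfl⟩ := hvp
          rw [← mem_selVars.1 (hg.2.1 hv), ← mem_selVars.1 (hg'.2.1 hv)]
        · exact congrFun h ⟨(ℓ, w), hp⟩
      calc (bad e).card ≤ Fintype.card ({p : Fin n × Win t // p ∉ T} → Fin (B + 1)) :=
            Finset.card_le_card_of_injOn _ (fun _ _ => Finset.mem_coe.2 (Finset.mem_univ _)) hinj
        _ = (B + 1) ^ (Fintype.card (Fin n × Win t) - T.card) := by
            rw [Fintype.card_fun, Fintype.card_fin, Fintype.card_subtype_compl, Fintype.card_coe]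
        _ ≤ (B + 1) ^ (Fintype.card (Fin n × Win t) - (s + 1)) :=
            Nat.pow_le_pow_right (Nat.succ_pos B) (by rw [hTcard]; omega)
    · rw [Finset.not_nonempty_iff_eq_empty.1 hne, Finset.card_empty]
      exact Nat.zero_le _
  -- so their union misses a selector
  have hunion : (M.biUnion bad).card < (Finset.univ : Finset (Fin n → Win t → Fin (B + 1))).card := by
    calc (M.biUnion bad).card ≤ ∑ e ∈ M, (bad e).card := Finset.card_biUnion_le
      _ ≤ ∑ _e ∈ M, (B + 1) ^ (Fintype.card (Fin n × Win t) - (s + 1)) :=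
          Finset.sum_le_sum fun e _ => hsmall e
      _ = M.card * (B + 1) ^ (Fintype.card (Fin n × Win t) - (s + 1)) := by
          rw [Finset.sum_const, smul_eq_mul]
      _ < (B + 1) ^ Fintype.card (Fin n × Win t) := hM
      _ = _ := by
          rw [Finset.card_univ, Fintype.card_fun, Fintype.card_fun, Fintype.card_fin, ← pow_mul,
            Fintype.card_prod, Nat.mul_comm]
  obtain ⟨g, -, hg⟩ := Finset.exists_mem_notMem_of_card_lt_card hunion
  refine ⟨g, fun e he hsub => ?_⟩
  by_contra hlt
  push Not at hlt
  exact hg (Finset.mem_biUnion.2 ⟨e, he, Finset.mem_filter.2 ⟨Finset.mem_univ _, hsub, hlt⟩⟩)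

end Words

end SlidingWindow

end Literature.Computability.AlgebraicComplexity
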